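import Summits.QuantumFields.BalabanUV.Beta.WilsonBackgroundWard22Columns
import Summits.QuantumFields.BalabanUV.Beta.WilsonJetDivergence
import Literature.MathematicalPhysics.QuantumFieldTheory.Balaban1983to89.Beta.PlaquetteVertex2

/-!
# The BACKGROUND-gauge Ward identity of the Wilson plaquette jets at order `(W², B¹)`; part 4: ALL LETTERS

Fourth file of (bgW₂) — READ THE HEADER of `Summits/QuantumFields/BalabanUV/Beta/WilsonBackgroundWard22.lean` (setting, provenance, honest
framing, what is NOT done).  THIS FILE states (bgW₂) per plaquette with the gauge parameter `λ = (l₁, l₂, l₃, l₄)` at the four corners, the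
background `B = (B₁, B₂, B₃, B₄)` and the fluctuation `h = (h₁, h₂, h₃, h₄)` ALL ARBITRARY — for every ring `𝔸`, every `𝕜`-linear TRACIAL `τ`:

  `4·[F_{2,2}(h; B + W₀λ) − F_{2,2}(h; B) − F_{2,2}(h; W₀λ)] + 4·[F_{2,1}(h + ad_λ h; B) − F_{2,1}(h; B) − F_{2,1}(ad_λ h; B)]
     + 2·F_{2,1}(h; [λ(b₋), B] + [λ(b₊), B]) = 0`,

`W₀λ = (l₁ − l₂, l₂ − l₃, l₄ − l₃, l₁ − l₄)`, `ad_λ h = ([l₁,h₁], [l₂,h₂], [l₄,h₃], [l₁,h₄])`, rotated background letters bond by bond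
`([l₁,B₁]+[l₂,B₁], [l₂,B₂]+[l₃,B₂], [l₃,B₃]+[l₄,B₃], [l₁,B₄]+[l₄,B₄])` (`bgWard22`; the collected form `[λ(b₋)+λ(b₊), B_b]` is `bgWard22'`).
PROOF: the four columns `WilsonBackgroundWard22Columns.bgWard22_x1 … x4` BY NAME, summed over the corners by `corner_sum₄` (`P22 ∘ plaq`
B-quadratic, an3's `WilsonWard22.P21_plaq_polar₃` W-quadratic, `P21 ∘ plaq` B-additive, `P21_plaq_zero` at the corner `x₃` where no bond
starts).  §2 sums it over all sites and ordered direction pairs of a finite lattice: **`jet22_bgWard`** — for fields `W B : Λ → D → 𝔸` and a site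
field `λ : Λ → 𝔸`, with an3's `PlaquetteVertex2.jet22` / `PlaquetteVertex.jet21`, the pure-gauge background `WilsonWardJets.gaugeDir₀ e λ`
(`= λ(b₋) − λ(b₊)`), leaf-05-g2's base-point conjugation `WilsonJetDivergence.adj λ W` and the endpoint-sum conjugation
`(λ(b₋) + λ(b₊))·B_b − B_b·(λ(b₋) + λ(b₊))` written inline:
`4·[jet22(W; B + gaugeDir₀ λ) − jet22(W; B) − jet22(W; gaugeDir₀ λ)] + 4·[jet21(W + adj λ W; B) − jet21(W; B) − jet21(adj λ W; B)] + 2·jet21(W; …) = 0`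
— the `(2,2)`-jet analogue of leaf-05-g2's `WilsonJetDivergence.jet21_grad`.  The stencil transcription (coordinates, colour stripping, the
(S₂-row law) of the W-side (L4) of row D1 / the (W2) socket of road BF-x for the Wilson sector, `ℤ^{d+1}`) is NOT here.

NOT IN PRINT; OUR BOOKKEEPING (cell `pub-balaban`, β sub-cell, D1 formalisation swarm seat `b2b-balaban-beta-d1-formalise-leaf-09`, gen 3).
HONEST FRAMING (cell contract, verbatim): «discharging `BetaPertH` makes Bałaban's UV stability UNCONDITIONAL — a real constructive-QFT
result; it is NOT the continuum limit and NOT the Clay problem.»  HONEST DEPENDENCY (verbatim): «continuum YM on T⁴ ⇐ BetaPertH ∧ nine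
spine estimates (0/9 proved); BetaPertH ⇐ (D1) ∧ (D4) ∧ CAP+tail; G-an2-4 gates asym, D1 and NE2/3/4.»  THIS FILE DISCHARGES NOTHING of the
wall; [folklore] multilinear algebra; no binder of (D1) instantiated; not summit progress, not continuum, not Clay.  ABSOLUTE RULE (cell,
verbatim): «No internally-minted statement may enter as a cited fact. Every hypothesis is either kernel-proved in this package or a verbatim
quotation of a PUBLISHED theorem with page reference. The manuscript(s) under audit are NOT citable for their own disputed steps — they are
the thing under adjudication; programme-internal (2001/route/tribunal) claims are never citable.»  Nothing cited; no `def`; kernel-proved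
from part 3 and an3's files BY NAME.
-/

namespace Summit.QuantumFields.BalabanUV.Beta.WilsonBackgroundWard22All

open Literature.MathematicalPhysics.QuantumFieldTheory.Balaban1983to89.Beta.TransportVertices
open Literature.MathematicalPhysics.QuantumFieldTheory.Balaban1983to89.Beta.WilsonVertex
open Literature.MathematicalPhysics.QuantumFieldTheory.Balaban1983to89.Beta.WilsonVertex2
open Literature.MathematicalPhysics.QuantumFieldTheory.Balaban1983to89.Beta.WilsonWard22 (P21_plaq_polar₃ P21_plaq_zero)
open Literature.MathematicalPhysics.QuantumFieldTheory.Balaban1983to89.Beta.PlaquetteVertex (plaqWord jet21)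
open Literature.MathematicalPhysics.QuantumFieldTheory.Balaban1983to89.Beta.PlaquetteVertex2 (jet22)
open Literature.MathematicalPhysics.QuantumFieldTheory.Balaban1983to89.Beta.WilsonWardJets (gaugeDir₀)
open Summit.QuantumFields.BalabanUV.Beta.WilsonJetDivergence (adj adj_apply)
open Summit.QuantumFields.BalabanUV.Beta.WilsonBackgroundWard22Columns

/-! ## §1 The all-letters identity, per plaquette -/

section AllLetters

variable (𝕜 : Type*) [RCLike 𝕜] {𝔸 : Type*} [NormedRing 𝔸] [NormedAlgebra 𝕜 𝔸]
variable {V : Type*} [AddCommGroup V] [Module 𝕜 V]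
variable (τ : 𝔸 →ₗ[𝕜] V) (h₁ h₂ h₃ h₄ B₁ B₂ B₃ B₄ l₁ l₂ l₃ l₄ : 𝔸)

/-- [folklore] **THE ORDER-`(W², B¹)` BACKGROUND-GAUGE WARD IDENTITY OF THE WILSON PLAQUETTE JETS, ALL LETTERS** (bgW₂): the gauge
parameter `λ = (l₁, l₂, l₃, l₄)` at the corners `x₁, x₂, x₃, x₄`, the background `B = (B₁, B₂, B₃, B₄)` and the fluctuation `h = (h₁, h₂, h₃, h₄)`
ARBITRARY on the bonds `b₁ : x₁ → x₂`, `b₂ : x₂ → x₃`, `b₃ : x₄ → x₃`, `b₄ : x₁ → x₄`: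
`4·Pol_B F_{2,2}(h ; B, W₀λ) + 4·Pol_W F_{2,1}(h, ad_λ h ; B) + 2·F_{2,1}(h ; [λ(b₋), B] + [λ(b₊), B]) = 0`, `W₀λ = (l₁ − l₂, l₂ − l₃, l₄ − l₃, l₁ − l₄)`,
`ad_λ h = ([l₁,h₁], [l₂,h₂], [l₄,h₃], [l₁,h₄])`, rotated letters `([l₁,B₁]+[l₂,B₁], [l₂,B₂]+[l₃,B₂], [l₃,B₃]+[l₄,B₃], [l₁,B₄]+[l₄,B₄])` — for every ring
`𝔸`, every `𝕜`-linear tracial `τ`, all letters.  PROOF: the four columns `bgWard22_x1 … x4` BY NAME, summed over the corners by `corner_sum₄`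
(`P22 ∘ plaq` B-quadratic, an3's `WilsonWard22.P21_plaq_polar₃` W-quadratic, `P21 ∘ plaq` B-additive). -/
theorem bgWard22 (hτ : ∀ a b : 𝔸, τ (a * b) = τ (b * a)) :
    (4 : 𝕜) • τ (P22 𝕜 (plaq h₁ h₂ h₃ h₄ (B₁ + (l₁ - l₂)) (B₂ + (l₂ - l₃)) (B₃ + (l₄ - l₃)) (B₄ + (l₁ - l₄))))
      - (4 : 𝕜) • τ (P22 𝕜 (plaq h₁ h₂ h₃ h₄ B₁ B₂ B₃ B₄))
      - (4 : 𝕜) • τ (P22 𝕜 (plaq h₁ h₂ h₃ h₄ (l₁ - l₂) (l₂ - l₃) (l₄ - l₃) (l₁ - l₄)))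
      + ((4 : 𝕜) • τ (P21 𝕜 (plaq (h₁ + (l₁ * h₁ - h₁ * l₁)) (h₂ + (l₂ * h₂ - h₂ * l₂)) (h₃ + (l₄ * h₃ - h₃ * l₄)) (h₄ + (l₁ * h₄ - h₄ * l₁)) B₁ B₂ B₃ B₄))
          - (4 : 𝕜) • τ (P21 𝕜 (plaq h₁ h₂ h₃ h₄ B₁ B₂ B₃ B₄))
          - (4 : 𝕜) • τ (P21 𝕜 (plaq (l₁ * h₁ - h₁ * l₁) (l₂ * h₂ - h₂ * l₂) (l₄ * h₃ - h₃ * l₄) (l₁ * h₄ - h₄ * l₁) B₁ B₂ B₃ B₄)))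
      + (2 : 𝕜) • τ (P21 𝕜 (plaq h₁ h₂ h₃ h₄ (l₁ * B₁ - B₁ * l₁ + (l₂ * B₁ - B₁ * l₂)) (l₂ * B₂ - B₂ * l₂ + (l₃ * B₂ - B₂ * l₃)) (l₃ * B₃ - B₃ * l₃ + (l₄ * B₃ - B₃ * l₄)) (l₁ * B₄ - B₄ * l₁ + (l₄ * B₄ - B₄ * l₄))))
      = 0 := by
  have key := corner_sum₄ (G := 𝔸 × 𝔸 × 𝔸 × 𝔸)
    (fun x => (4 : 𝕜) • τ (P22 𝕜 (plaq h₁ h₂ h₃ h₄ x.1 x.2.1 x.2.2.1 x.2.2.2)))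
    (fun x => (4 : 𝕜) • τ (P21 𝕜 (plaq x.1 x.2.1 x.2.2.1 x.2.2.2 B₁ B₂ B₃ B₄)))
    (fun x => (2 : 𝕜) • τ (P21 𝕜 (plaq h₁ h₂ h₃ h₄ x.1 x.2.1 x.2.2.1 x.2.2.2)))
    (by
      rintro ⟨x₁, x₂, x₃, x₄⟩ ⟨y₁, y₂, y₃, y₄⟩ ⟨z₁, z₂, z₃, z₄⟩
      have e := congrArg (fun a : 𝔸 => (4 : 𝕜) • τ a) (P22_plaq_polarB₃ 𝕜 h₁ h₂ h₃ h₄ x₁ x₂ x₃ x₄ y₁ y₂ y₃ y₄ z₁ z₂ z₃ z₄)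
      simpa only [Prod.mk_add_mk, map_add, map_sub, map_zero, smul_add, smul_sub, smul_zero] using e)
    (by
      rintro ⟨x₁, x₂, x₃, x₄⟩ ⟨y₁, y₂, y₃, y₄⟩ ⟨z₁, z₂, z₃, z₄⟩
      have e := congrArg (fun a : 𝔸 => (4 : 𝕜) • τ a) (P21_plaq_polar₃ 𝕜 B₁ B₂ B₃ B₄ x₁ x₂ x₃ x₄ y₁ y₂ y₃ y₄ z₁ z₂ z₃ z₄)
      simpa only [Prod.mk_add_mk, map_add, map_sub, map_zero, smul_add, smul_sub, smul_zero] using e)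
    (by
      rintro ⟨x₁, x₂, x₃, x₄⟩ ⟨y₁, y₂, y₃, y₄⟩
      simp only [Prod.mk_add_mk, P21_plaq_addB, map_add, smul_add])
    (B₁, B₂, B₃, B₄) (h₁, h₂, h₃, h₄)
    (l₁, 0, 0, l₁) (-l₂, l₂, 0, 0) (0, -l₃, -l₃, 0) (0, 0, l₄, -l₄)
    ((l₁ * h₁ - h₁ * l₁), 0, 0, (l₁ * h₄ - h₄ * l₁)) (0, (l₂ * h₂ - h₂ * l₂), 0, 0) (0 : 𝔸 × 𝔸 × 𝔸 × 𝔸) (0, 0, (l₄ * h₃ - h₃ * l₄), 0)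
    ((l₁ * B₁ - B₁ * l₁), 0, 0, (l₁ * B₄ - B₄ * l₁)) ((l₂ * B₁ - B₁ * l₂), (l₂ * B₂ - B₂ * l₂), 0, 0) (0, (l₃ * B₂ - B₂ * l₃), (l₃ * B₃ - B₃ * l₃), 0) (0, 0, (l₄ * B₃ - B₃ * l₄), (l₄ * B₄ - B₄ * l₄))
    (by
      simpa only [Prod.mk_add_mk, Prod.fst_zero, Prod.snd_zero, add_zero, zero_add, ← sub_eq_add_neg, zero_sub, sub_self, sub_zero, P21_plaq_zeroB, P21_plaq_zero, map_zero, smul_zero]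
        using bgWard22_x1 𝕜 τ h₁ h₂ h₃ h₄ B₁ B₂ B₃ B₄ l₁ hτ)
    (by
      simpa only [Prod.mk_add_mk, Prod.fst_zero, Prod.snd_zero, add_zero, zero_add, ← sub_eq_add_neg, zero_sub, sub_self, sub_zero, P21_plaq_zeroB, P21_plaq_zero, map_zero, smul_zero]
        using bgWard22_x2 𝕜 τ h₁ h₂ h₃ h₄ B₁ B₂ B₃ B₄ l₂ hτ)
    (by
      simpa only [Prod.mk_add_mk, Prod.fst_zero, Prod.snd_zero, add_zero, zero_add, ← sub_eq_add_neg, zero_sub, sub_self, sub_zero, P21_plaq_zeroB, P21_plaq_zero, map_zero, smul_zero]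
        using bgWard22_x3 𝕜 τ h₁ h₂ h₃ h₄ B₁ B₂ B₃ B₄ l₃ hτ)
    (by
      simpa only [Prod.mk_add_mk, Prod.fst_zero, Prod.snd_zero, add_zero, zero_add, ← sub_eq_add_neg, zero_sub, sub_self, sub_zero, P21_plaq_zeroB, P21_plaq_zero, map_zero, smul_zero]
        using bgWard22_x4 𝕜 τ h₁ h₂ h₃ h₄ B₁ B₂ B₃ B₄ l₄ hτ)
  simpa only [Prod.mk_add_mk, Prod.fst_zero, Prod.snd_zero, add_zero, zero_add, zero_sub, ← sub_eq_add_neg, neg_add_eq_sub]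
    using key

/-- [folklore] (bgW₂), ALL LETTERS, with the rotated background letters collected as `[λ(b₋) + λ(b₊), B_b]` (the letter `2·D₁λ B`). -/
theorem bgWard22' (hτ : ∀ a b : 𝔸, τ (a * b) = τ (b * a)) :
    (4 : 𝕜) • τ (P22 𝕜 (plaq h₁ h₂ h₃ h₄ (B₁ + (l₁ - l₂)) (B₂ + (l₂ - l₃)) (B₃ + (l₄ - l₃)) (B₄ + (l₁ - l₄))))
      - (4 : 𝕜) • τ (P22 𝕜 (plaq h₁ h₂ h₃ h₄ B₁ B₂ B₃ B₄))
      - (4 : 𝕜) • τ (P22 𝕜 (plaq h₁ h₂ h₃ h₄ (l₁ - l₂) (l₂ - l₃) (l₄ - l₃) (l₁ - l₄)))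
      + ((4 : 𝕜) • τ (P21 𝕜 (plaq (h₁ + (l₁ * h₁ - h₁ * l₁)) (h₂ + (l₂ * h₂ - h₂ * l₂)) (h₃ + (l₄ * h₃ - h₃ * l₄)) (h₄ + (l₁ * h₄ - h₄ * l₁)) B₁ B₂ B₃ B₄))
          - (4 : 𝕜) • τ (P21 𝕜 (plaq h₁ h₂ h₃ h₄ B₁ B₂ B₃ B₄))
          - (4 : 𝕜) • τ (P21 𝕜 (plaq (l₁ * h₁ - h₁ * l₁) (l₂ * h₂ - h₂ * l₂) (l₄ * h₃ - h₃ * l₄) (l₁ * h₄ - h₄ * l₁) B₁ B₂ B₃ B₄)))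
      + (2 : 𝕜) • τ (P21 𝕜 (plaq h₁ h₂ h₃ h₄ ((l₁ + l₂) * B₁ - B₁ * (l₁ + l₂)) ((l₂ + l₃) * B₂ - B₂ * (l₂ + l₃)) ((l₄ + l₃) * B₃ - B₃ * (l₄ + l₃)) ((l₁ + l₄) * B₄ - B₄ * (l₁ + l₄))))
      = 0 := by
  have e₁ : (l₁ + l₂) * B₁ - B₁ * (l₁ + l₂) = l₁ * B₁ - B₁ * l₁ + (l₂ * B₁ - B₁ * l₂) := by noncomm_ring
  have e₂ : (l₂ + l₃) * B₂ - B₂ * (l₂ + l₃) = l₂ * B₂ - B₂ * l₂ + (l₃ * B₂ - B₂ * l₃) := by noncomm_ring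
  have e₃ : (l₄ + l₃) * B₃ - B₃ * (l₄ + l₃) = l₃ * B₃ - B₃ * l₃ + (l₄ * B₃ - B₃ * l₄) := by noncomm_ring
  have e₄ : (l₁ + l₄) * B₄ - B₄ * (l₁ + l₄) = l₁ * B₄ - B₄ * l₁ + (l₄ * B₄ - B₄ * l₄) := by noncomm_ring
  rw [e₁, e₂, e₃, e₄]
  exact bgWard22 𝕜 τ h₁ h₂ h₃ h₄ B₁ B₂ B₃ B₄ l₁ l₂ l₃ l₄ hτ

end AllLetters

/-! ## §2 The lattice-summed form -/

section Lattice

variable (𝕜 : Type*) [RCLike 𝕜] {𝔸 : Type*} [NormedRing 𝔸] [NormedAlgebra 𝕜 𝔸]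
variable {V : Type*} [AddCommGroup V] [Module 𝕜 V]
variable {Λ : Type*} [Fintype Λ] [AddCommGroup Λ] {D : Type*} [Fintype D]

/-- [folklore] **(bgW₂) SUMMED OVER A FINITE LATTICE** (all sites, all ordered direction pairs — the bookkeeping of an3's `jet22`/`jet21`):
for fields `W B : Λ → D → 𝔸`, a site field `λ : Λ → 𝔸` and every tracial `τ`,
`4·[jet22(W; B + gaugeDir₀ λ) − jet22(W; B) − jet22(W; gaugeDir₀ λ)] + 4·[jet21(W + adj λ W; B) − jet21(W; B) − jet21(adj λ W; B)]
 + 2·jet21(W; (λ(b₋)+λ(b₊))·B − B·(λ(b₋)+λ(b₊))) = 0`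
(`gaugeDir₀ e λ y δ = λ y − λ (y + e_δ)`, `adj λ W y δ = λ y·W_δ(y) − W_δ(y)·λ y`).  Plaquette by plaquette this is `bgWard22'` at the corner
parameters `(λ x, λ (x+e_μ), λ (x+e_μ+e_ν), λ (x+e_ν))`. -/
theorem jet22_bgWard (τ : 𝔸 →ₗ[𝕜] V) (hτ : ∀ a b : 𝔸, τ (a * b) = τ (b * a)) (e : D → Λ) (W B : Λ → D → 𝔸) (lam : Λ → 𝔸) :
    (4 : 𝕜) • jet22 𝕜 τ e W (B + gaugeDir₀ e lam) - (4 : 𝕜) • jet22 𝕜 τ e W B - (4 : 𝕜) • jet22 𝕜 τ e W (gaugeDir₀ e lam)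
      + ((4 : 𝕜) • jet21 𝕜 τ e (W + adj lam W) B - (4 : 𝕜) • jet21 𝕜 τ e W B - (4 : 𝕜) • jet21 𝕜 τ e (adj lam W) B)
      + (2 : 𝕜) • jet21 𝕜 τ e W (fun y δ => (lam y + lam (y + e δ)) * B y δ - B y δ * (lam y + lam (y + e δ))) = 0 := by
  have key : ∀ (x : Λ) (μ ν : D),
      (4 : 𝕜) • τ (P22 𝕜 (plaqWord e W (B + gaugeDir₀ e lam) x μ ν)) - (4 : 𝕜) • τ (P22 𝕜 (plaqWord e W B x μ ν))
        - (4 : 𝕜) • τ (P22 𝕜 (plaqWord e W (gaugeDir₀ e lam) x μ ν))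
        + ((4 : 𝕜) • τ (P21 𝕜 (plaqWord e (W + adj lam W) B x μ ν)) - (4 : 𝕜) • τ (P21 𝕜 (plaqWord e W B x μ ν))
            - (4 : 𝕜) • τ (P21 𝕜 (plaqWord e (adj lam W) B x μ ν)))
        + (2 : 𝕜) • τ (P21 𝕜 (plaqWord e W
            (fun y δ => (lam y + lam (y + e δ)) * B y δ - B y δ * (lam y + lam (y + e δ))) x μ ν)) = 0 := by
    intro x μ ν
    have h3 : x + e ν + e μ = x + e μ + e ν := add_right_comm _ _ _
    simp only [plaqWord, Pi.add_apply, gaugeDir₀, adj_apply, h3]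
    exact bgWard22' 𝕜 τ (W x μ) (W (x + e μ) ν) (W (x + e ν) μ) (W x ν) (B x μ) (B (x + e μ) ν) (B (x + e ν) μ) (B x ν)
      (lam x) (lam (x + e μ)) (lam (x + e μ + e ν)) (lam (x + e ν)) hτ
  calc _ = ∑ x, ∑ μ, ∑ ν,
        ((4 : 𝕜) • τ (P22 𝕜 (plaqWord e W (B + gaugeDir₀ e lam) x μ ν)) - (4 : 𝕜) • τ (P22 𝕜 (plaqWord e W B x μ ν))
          - (4 : 𝕜) • τ (P22 𝕜 (plaqWord e W (gaugeDir₀ e lam) x μ ν))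
          + ((4 : 𝕜) • τ (P21 𝕜 (plaqWord e (W + adj lam W) B x μ ν)) - (4 : 𝕜) • τ (P21 𝕜 (plaqWord e W B x μ ν))
              - (4 : 𝕜) • τ (P21 𝕜 (plaqWord e (adj lam W) B x μ ν)))
          + (2 : 𝕜) • τ (P21 𝕜 (plaqWord e W
              (fun y δ => (lam y + lam (y + e δ)) * B y δ - B y δ * (lam y + lam (y + e δ))) x μ ν))) := by
        simp only [jet22, jet21, Finset.smul_sum, ← Finset.sum_sub_distrib, ← Finset.sum_add_distrib]
    _ = 0 := Finset.sum_eq_zero fun x _ => Finset.sum_eq_zero fun μ _ => Finset.sum_eq_zero fun ν _ => key x μ ν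

end Lattice

end Summit.QuantumFields.BalabanUV.Beta.WilsonBackgroundWard22All
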